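import Mathlib.Analysis.SpecialFunctions.Pow.Real
import Literature.AlgebraicGeometry.Frobenioids.Thm36Sub
import Literature.AlgebraicGeometry.Frobenioids.Thm36SubProofs
import Literature.AlgebraicGeometry.Frobenioids.Thm36SubIstrTypesQ
import Literature.AlgebraicGeometry.Frobenioids.ArchimedeanIndissectible
import Literature.AlgebraicGeometry.Frobenioids.CoAngular
import HarnessLib

/-!
# Frobenioids II, Theorem 3.6 (ix) for `C^ℚ := C^pf` — PROVED over THE perfection (slot `ix_Q`)

Mochizuki, *The geometry of Frobenioids II: poly-Frobenioids*, Kyushu J. Math. **62** (2008) 401–460, §3,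
Theorem 3.6 (ix), kurims text `paper:url-4322d76898e0` p. 38 [cite: MochizukiFrdII2008, Thm 3.6 (ix) p.38]:
"(ix) Suppose that `D` is of strongly indissectible type. If `D` is not complexifiable, then we assume further
that `Λ ≠ ℤ`. Then `F^istr` is of strongly indissectible type." — proof p. 39: "by reducing […] to the easily
verified fact that the categories `(C^Λ_0)^istr[ℝ]` [when `Λ ≠ ℤ`], `(C^Λ_0)^istr[ℂ]` […] are of strongly
indissectible type."  This file closes the slot `ArchFrd.Thm36Sub.ix_Q` of `Thm36Sub.lean` (abc-iut cell, L1
row M13, typed by abc-iut-w4-d074; proved by abc-iut-w5-d036): the `Λ = ℚ` conjunct of abc-iut-L1-t9's instance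
statement `Thm36ix` over THE perfection `C^pf` ([FrdI] Def. 3.1 (iii)) of the archimedean Frobenioid
`C = C₀ ×_{D₀} D` of Example 3.3, over ANY base `π : D → D₀` — in particular over a REAL, non-complexifiable
corner, where the `Λ = ℤ` statement fails (a unit `w < 0` of `ℝ` has no square root) and the perfection repairs
it: two arrows of `C` whose scalars differ by a SIGN have the same class in `C^pf`, the transport to an even
Frobenius level squaring the scalars.

PROOF (kernel-checked below). Let `φᵢ : X̂ᵢ → Â` (`i = 0, 1`) be arrows of `(C^pf)^istr`. (0) Representatives
`fᵢ : Xᵢ^{(aᵢ)} → A^{(c)}` with a COMMON target power, the levels enlarged until the `Xᵢ^{(aᵢ)}` are isotropic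
in `C` (Ex. 3.3 (ii) Frobenius-isotropy + [FrdI] Def. 1.3 (vii)(b), `exists_dvd_isIsotropic_frobPow`), i.e.
discs. (1) Strong indissectibility of `D`: a square `k₀ ≫ Base(φ₀) = k₁ ≫ Base(φ₁)` from some `b`
(`Indissect.exists_square`), transported under the representatives along `Base(frob)`. (2) Over `b`: the disc
`B` of a tiny tip `t ≤ 1` and arrows `g₀ = (e₀, deg f₁, s₀)`, `g₁ = (e₁, deg f₀, 1)` of `C`, with
`(s₀^{deg f₀})² = w²`, `w := ι₀(c₀)⁻¹ · ι₁(c₁)` (honest root if `b` is complex, `|w|^{1/deg f₀} ∈ ℝ_{>0}` if `b`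
is real: `exists_scalar_pow_sq_eq`); so `hᵢ := gᵢ ≫ fᵢ` have equal `D`-parts, degrees, and `σ₀² = σ₁²`. (3) In
`C^pf`: `B̂ := (B, k·c)`, `ψᵢ := [frob_{B,1}⁻¹ ≫ gᵢ]` at the level `(1, aᵢ)` (`frob_{B,1}` is an isomorphism,
[FrdI] Prop. 1.4 (iii)), and `ψᵢ ≫ φᵢ = [frob_{B,1}⁻¹ ≫ hᵢ]` at `(1, c)`. (4) The two classes agree at the level
`(2, 2c)`: `h₀ ≫ Fr = h₁ ≫ Fr` for the degree-`2` transition `Fr : A^{(c)} → A^{(2c)}`, the scalar of `h ≫ Fr`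
being `Base(h).act(scalar Fr) · σ²`. (5) `B̂` is isotropic (`istrAll_Q_holds`) and non-initial in every full
subcategory (it has an endomorphism of `deg_Fr = 2`).  Proof-only companion (no `def`); `hF` is the PARAMETER of
the slot (print's "`C` is a Frobenioid", the input of the construction of `C^pf`); nothing of the paper is
re-typed or strengthened; classical; nothing here bears on [IUTchIII] Cor. 3.12.
-/

noncomputable section

namespace Literature.AlgebraicGeometry.Frobenioids

open CategoryTheory Opposite

universe v u

namespace ArchFrd

namespace Thm36Sub

variable {D : Type u} [Category.{v} D] (π : D ⥤ D0)

/-- Over any `K ∈ Ob(D₀)`, every scalar `w ∈ K^×` and every `n ≥ 1` admit a scalar `s ∈ K^×` with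
`(s^n)² = w²`: an `n`-th root of `w` if `K` is complex, the positive real `|w|^{1/n}` if `K` is real (where
`w ∈ ℝ^×`, so `|w|² = w²`). This is the step where the perfection (which only sees scalars up to the squaring
of an even Frobenius level) escapes the `Λ = ℤ` obstruction of Theorem 3.6 (ix) over a real base.
[cite: MochizukiFrdII2008, Thm 3.6 (ix) p.38] -/
theorem exists_scalar_pow_sq_eq (K : D0) {w : ℂˣ} (hw : w ∈ D0.scalars K) (n : ℕ+) :
    ∃ s ∈ D0.scalars K, (s ^ (n : ℕ)) ^ 2 = w ^ 2 := by
  rcases D0.isReal_or_isComplex K with hK | hK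
  · -- real base: `w` is a nonzero real number; take the positive real `n`-th root of `|w|`
    have hK' : K = D0.real := hK
    subst hK'
    have him : (w : ℂ).im = 0 := (D0.mem_scalars_real_iff w).mp hw
    set a : ℝ := (w : ℂ).re with ha
    have hwre : (w : ℂ) = (a : ℂ) := Complex.ext (by simp [ha]) (by simp [him])
    set r : ℝ := ‖(w : ℂ)‖ with hr
    have hrpos : 0 < r := norm_pos_iff.mpr w.ne_zero
    set x : ℝ := r ^ ((n : ℕ) : ℝ)⁻¹ with hx
    have hxpos : 0 < x := Real.rpow_pos_of_pos hrpos _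
    refine ⟨ofPosReal ℂ ⟨x, hxpos⟩, ofPosReal_mem_scalars _ _, ?_⟩
    apply Units.ext
    have hxn : x ^ (n : ℕ) = r := by
      rw [hx]
      exact Real.rpow_inv_natCast_pow hrpos.le n.ne_zero
    have hr' : r = |a| := by
      rw [hr, hwre, Complex.norm_real, Real.norm_eq_abs]
    rw [Units.val_pow_eq_pow_val, Units.val_pow_eq_pow_val, Units.val_pow_eq_pow_val, coe_ofPosReal]
    change (((x : ℝ) : ℂ) ^ (n : ℕ)) ^ 2 = (w : ℂ) ^ 2
    rw [← Complex.ofReal_pow, hxn, hr', hwre, ← Complex.ofReal_pow, ← Complex.ofReal_pow, sq_abs]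
  · -- complex base: every unit has an `n`-th root
    have hK' : K = D0.complex := hK
    subst hK'
    obtain ⟨z, hz⟩ := Indissect.exists_units_pow_eq w n.pos
    exact ⟨z, by rw [D0.scalars_complex]; exact Subgroup.mem_top _, by rw [hz]⟩

/-- In `C = C₀ ×_{D₀} D`, two parallel arrows `h₀, h₁ : Y → Z` with the same `D`-component, the same Frobenius
degree and scalars with `σ₀² = σ₁²` become equal after composition with any arrow `θ : Z → W` of Frobenius
degree `2`: the scalar of `h ≫ θ` is `Base(h).act(scalar θ) · σ^{2}` (Example 3.3 (i), composition rule).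
[cite: MochizukiFrdII2008, Ex 3.3 (i) p.27] -/
theorem comp_eq_comp_of_scalar_sq_eq {Y Z W : C π} (h₀ h₁ : Y ⟶ Z) (θ : Z ⟶ W)
    (hθ : (C0.degFr θ.fst : ℕ) = 2) (hs : h₀.snd = h₁.snd) (hd : C0.degFr h₀.fst = C0.degFr h₁.fst)
    (hσ : C0.scalar h₀.fst ^ 2 = C0.scalar h₁.fst ^ 2) : h₀ ≫ θ = h₁ ≫ θ := by
  have hb : C0.Base h₀.fst = C0.Base h₁.fst := by
    have w₀ := PreFrobenioid.FiberProduct.hom_w h₀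
    have w₁ := PreFrobenioid.FiberProduct.hom_w h₁
    change C0.Base h₀.fst ≫ Z.iso.hom = Y.iso.hom ≫ π.map h₀.snd at w₀
    change C0.Base h₁.fst ≫ Z.iso.hom = Y.iso.hom ≫ π.map h₁.snd at w₁
    rw [hs] at w₀
    exact (cancel_mono Z.iso.hom).mp (w₀.trans w₁.symm)
  refine CFP.hom_ext (C0.hom_ext ?_ ?_ ?_) ?_
  · rw [CFP.comp_fst, CFP.comp_fst, C0.base_comp', C0.base_comp', hb]
  · rw [CFP.comp_fst, CFP.comp_fst, C0.degFr_comp', C0.degFr_comp', hd]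
  · rw [CFP.comp_fst, CFP.comp_fst, C0.scalar_comp', C0.scalar_comp', hb, hθ, hσ]
  · rw [CFP.comp_snd, CFP.comp_snd, hs]

/-- The degree-`2` transition `A^{(c)} → A^{(c·2)}` between chosen Frobenius powers has `C₀`-degree `2`.
[cite: MochizukiFrdI2008, Def. 3.1 (ii) p.56] -/
theorem degFr_fst_frobTrans_two (hF : PreFrobenioid.IsFrobenioid (C.toElem π)) (A : C π) (c : ℕ+) :
    (C0.degFr (PreFrobenioid.frobTrans hF A (dvd_mul_right c 2)).fst : ℕ) = 2 := by
  have h := congrArg PNat.val (PreFrobenioid.degFr_frobTrans hF A (dvd_mul_right c 2))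
  simp only [PNat.mul_coe] at h
  exact Nat.eq_of_mul_eq_mul_left c.pos h

/-- The chosen degree-one Frobenius arrow `B → B^{(1)}` is an isomorphism ([FrdI] Prop. 1.4 (iii): an
LB-invertible pre-step of a Frobenioid is an isomorphism). [cite: MochizukiFrdI2008, Prop. 1.4 (iii) p.27] -/
theorem isIso_frob_one (hF : PreFrobenioid.IsFrobenioid (C.toElem π)) (B : C π) :
    IsIso (PreFrobenioid.frob hF B 1) :=
  PreFrobenioid.isIso_of_isLBInvertible_of_isPreStep (C.toElem π) hF _
    (PreFrobenioid.isFrobeniusType_frob hF B 1).1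
    ⟨PreFrobenioid.degFr_frob hF B 1, (PreFrobenioid.isFrobeniusType_frob hF B 1).2⟩

/-- For the disc `B` of tip `t ≤ 1` over `b ∈ Ob(D)` and any `m`, the object `(B, m)` of THE perfection is
NON-INITIAL in every full subcategory of `C^pf` containing it: the class at level `(1, 1)` of the Prop. 1.10
(i) conjugate of the degree-`2` endomorphism `(id, 2, 1)` of `B` (region condition: `t² ≤ t`) is an
endomorphism of `(B, m)` of Frobenius degree `2`, hence `≠ id`. [cite: MochizukiFrdII2008, Thm 3.6 (ix) p.38] -/
theorem isNonemptyObj_root_disc (hF : PreFrobenioid.IsFrobenioid (C.toElem π)) (b : D) (t : PosReal)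
    (ht : (t : ℝ) ≤ 1) (m : ℕ+) (P : ObjectProperty (PreFrobenioid.Perfection hF))
    (hP : P (PreFrobenioid.Perfection.root hF
      (⟨⟨π.obj b, AngularRegion.isotropicOfTip t, fun _ => AngularRegion.isIsotropic_isotropicOfTip _⟩,
        b, Iso.refl _⟩ : C π) m)) :
    IsNonemptyObj (⟨_, hP⟩ : P.FullSubcategory) := by
  refine ⟨fun hI => ?_⟩
  let B : C π :=
    ⟨⟨π.obj b, AngularRegion.isotropicOfTip t, fun _ => AngularRegion.isIsotropic_isotropicOfTip _⟩,
      b, Iso.refl _⟩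
  have hst : ‖((1 : ℂˣ) : ℂ)‖ * (t : ℝ) ^ (((2 : ℕ+) : ℕ)) ≤ (B.fst.region.tip : ℝ) := by
    rw [Units.val_one, norm_one, one_mul]
    change (t : ℝ) ^ 2 ≤ (t : ℝ)
    nlinarith [t.2]
  let e₂ : B ⟶ B :=
    { fst :=
        { base := 𝟙 B.fst.base, degFr := 2, scalar := 1, scalar_mem := one_mem _,
          mapsTo := Indissect.smul_disc_pow_subset_pullRegion B.fst
            (AngularRegion.isIsotropic_isotropicOfTip _) (𝟙 B.fst.base) t 2 1 hst }
      snd := 𝟙 b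
      w := by
        change 𝟙 _ ≫ B.iso.hom = B.iso.hom ≫ π.map (𝟙 b)
        rw [CategoryTheory.Functor.map_id, Category.id_comp, Category.comp_id] }
  have hdeg_e₂ : PreFrobenioid.degFr (C.toElem π) e₂ = 2 := rfl
  let θ := (PreFrobenioid.Perfection.toPfRep hF e₂).hom
  have hθ : PreFrobenioid.frob hF B 1 ≫ θ = e₂ ≫ PreFrobenioid.frob hF B 1 :=
    PreFrobenioid.Perfection.frob_toPfRep e₂
  have hdegθ : PreFrobenioid.degFr (C.toElem π) θ = 2 := by
    have h := congrArg (PreFrobenioid.degFr (C.toElem π)) hθ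
    rw [PreFrobenioid.degFr_comp, PreFrobenioid.degFr_comp, PreFrobenioid.degFr_frob, hdeg_e₂,
      one_mul, mul_one] at h
    exact h
  let X : PreFrobenioid.Perfection hF := PreFrobenioid.Perfection.root hF B m
  have hI' : Limits.IsInitial (⟨X, hP⟩ : P.FullSubcategory) := hI
  let ρ : PreFrobenioid.Perfection.Rep X X := ⟨⟨1, 1, rfl⟩, θ⟩
  have hne : (PreFrobenioid.Perfection.Hom.mk ρ : X ⟶ X) ≠ 𝟙 X := by
    intro h
    have h' := congrArg PreFrobenioid.Perfection.Hom.degFr h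
    rw [PreFrobenioid.Perfection.degFr_mk, PreFrobenioid.Perfection.degFr_id'] at h'
    change PreFrobenioid.degFr (C.toElem π) θ = 1 at h'
    rw [hdegθ] at h'
    exact absurd h' (by decide)
  have key := hI'.hom_ext
    (P.homMk (PreFrobenioid.Perfection.Hom.mk ρ) : (⟨X, hP⟩ : P.FullSubcategory) ⟶ ⟨X, hP⟩) (𝟙 _)
  exact hne (congrArg InducedCategory.Hom.hom key)

/-- `Base` of the class of a representative `f : Y^{(a)} → A^{(c)}`, followed by `Base(frob_{A,c})`, is
`Base(frob_{Y,a}) ≫ f_D` ([FrdI] Prop. 3.2 (i): `Base([f]) = Base(frob_Y) ≫ Base(f) ≫ Base(frob_A)⁻¹`).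
[cite: MochizukiFrdI2008, Prop. 3.2 (i) p.58] -/
theorem baseMap_mk_comp_base_frob (hF : PreFrobenioid.IsFrobenioid (C.toElem π))
    {Y Â : PreFrobenioid.Perfection hF} {a c : ℕ+} (h : Y.idx * a = Â.idx * c)
    (f : PreFrobenioid.frobPow hF Y.obj a ⟶ PreFrobenioid.frobPow hF Â.obj c) {y : D}
    (k : y ⟶ PreFrobenioid.baseObj (C.toElem π) Y.obj) :
    (k ≫ PreFrobenioid.Perfection.Hom.baseMap (PreFrobenioid.Perfection.Hom.mk ⟨⟨a, c, h⟩, f⟩)) ≫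
        PreFrobenioid.Base (C.toElem π) (PreFrobenioid.frob hF Â.obj c) =
      k ≫ PreFrobenioid.Base (C.toElem π) (PreFrobenioid.frob hF Y.obj a) ≫ PreFrobenioid.Base (C.toElem π) f := by
  rw [PreFrobenioid.Perfection.baseMap_mk]
  unfold PreFrobenioid.Perfection.Rep.baseMap
  simp only [Category.assoc, PreFrobenioid.baseInvFrob_base_frob, Category.comp_id]

/-- **The core construction.** For two representatives `f₀ : X₀^{(a₀)} → A^{(c)}`, `f₁ : X₁^{(a₁)} → A^{(c)}` of
arrows `X̂₀ → Â ← X̂₁` of THE perfection with a COMMON target Frobenius power and with DISC sources, and a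
commutative square `k₀ ≫ (f₀)_D = k₁ ≫ (f₁)_D` in `D` from some `b`: there are an object `B̂` of `C^pf` (a formal
root of a small disc over `b`), non-initial in the full subcategory `P ⊇ Ob(C^pf)` considered, and arrows
`ψᵢ : B̂ → X̂ᵢ` with `ψ₀ ≫ [f₀] = ψ₁ ≫ [f₁]` — the sign discrepancy of the scalars over a real corner being killed
by the transport to the even level `(2, 2c)`. [cite: MochizukiFrdII2008, Thm 3.6 (ix) p.38] -/
theorem exists_pf_square (hF : PreFrobenioid.IsFrobenioid (C.toElem π))
    (P : ObjectProperty (PreFrobenioid.Perfection hF)) (hPall : ∀ Z, P Z)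
    {X₀ X₁ : P.FullSubcategory} {Â : PreFrobenioid.Perfection hF} {a₀ a₁ c : ℕ+}
    (h₀ : X₀.obj.idx * a₀ = Â.idx * c) (h₁ : X₁.obj.idx * a₁ = Â.idx * c)
    (f₀ : PreFrobenioid.frobPow hF X₀.obj.obj a₀ ⟶ PreFrobenioid.frobPow hF Â.obj c)
    (f₁ : PreFrobenioid.frobPow hF X₁.obj.obj a₁ ⟶ PreFrobenioid.frobPow hF Â.obj c)
    (hX₀ : (PreFrobenioid.frobPow hF X₀.obj.obj a₀).fst.IsNaivelyIsotropic)
    (hX₁ : (PreFrobenioid.frobPow hF X₁.obj.obj a₁).fst.IsNaivelyIsotropic)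
    {b : D} (k₀ : b ⟶ (PreFrobenioid.frobPow hF X₀.obj.obj a₀).snd)
    (k₁ : b ⟶ (PreFrobenioid.frobPow hF X₁.obj.obj a₁).snd) (hk : k₀ ≫ f₀.snd = k₁ ≫ f₁.snd) :
    ∃ (Bh : P.FullSubcategory) (ψ₀ : Bh ⟶ X₀) (ψ₁ : Bh ⟶ X₁), IsNonemptyObj Bh ∧
      ψ₀.hom ≫ PreFrobenioid.Perfection.Hom.mk ⟨⟨a₀, c, h₀⟩, f₀⟩ =
        ψ₁.hom ≫ PreFrobenioid.Perfection.Hom.mk ⟨⟨a₁, c, h₁⟩, f₁⟩ := by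
  let Z₀ : C π := PreFrobenioid.frobPow hF X₀.obj.obj a₀
  let Z₁ : C π := PreFrobenioid.frobPow hF X₁.obj.obj a₁
  set d₀ : ℕ+ := C0.degFr f₀.fst with hd₀
  set d₁ : ℕ+ := C0.degFr f₁.fst with hd₁
  set e₀ : π.obj b ⟶ Z₀.fst.base := π.map k₀ ≫ Z₀.iso.inv with he₀
  set e₁ : π.obj b ⟶ Z₁.fst.base := π.map k₁ ≫ Z₁.iso.inv with he₁
  set w : ℂˣ := (e₀.act (C0.scalar f₀.fst))⁻¹ * e₁.act (C0.scalar f₁.fst) with hw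
  have hwmem : w ∈ D0.scalars (π.obj b) :=
    mul_mem (inv_mem (C0.act_mem_scalars e₀ f₀.fst.scalar_mem)) (C0.act_mem_scalars e₁ f₁.fst.scalar_mem)
  obtain ⟨s₀, hs₀mem, hs₀⟩ := exists_scalar_pow_sq_eq (π.obj b) hwmem d₀
  set t₀ : ℝ := (Z₀.fst.region.tip : ℝ) with ht₀
  set t₁ : ℝ := (Z₁.fst.region.tip : ℝ) with ht₁
  have ht₀pos : 0 < t₀ := Z₀.fst.region.tip.2
  have ht₁pos : 0 < t₁ := Z₁.fst.region.tip.2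
  set μ : ℝ := min 1 (min t₀ t₁) with hμ
  have hμpos : 0 < μ := lt_min one_pos (lt_min ht₀pos ht₁pos)
  have hμ1 : μ ≤ 1 := min_le_left _ _
  have hμ₀ : μ ≤ t₀ := (min_le_right _ _).trans (min_le_left _ _)
  have hμ₁ : μ ≤ t₁ := (min_le_right _ _).trans (min_le_right _ _)
  set N : ℝ := ‖(s₀ : ℂ)‖ + 1 with hN
  have hNpos : 0 < N := by positivity
  have hN1 : 1 ≤ N := by rw [hN]; linarith [norm_nonneg (s₀ : ℂ)]
  let t : PosReal := ⟨μ / N, div_pos hμpos hNpos⟩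
  have htμ : (t : ℝ) ≤ μ := div_le_self hμpos.le hN1
  have ht1 : (t : ℝ) ≤ 1 := htμ.trans hμ1
  have htpow : ∀ m : ℕ+, (t : ℝ) ^ (m : ℕ) ≤ (t : ℝ) :=
    fun m => pow_le_of_le_one t.2.le ht1 m.ne_zero
  have hst₀ : ‖(s₀ : ℂ)‖ * (t : ℝ) ^ (d₁ : ℕ) ≤ t₀ := by
    calc ‖(s₀ : ℂ)‖ * (t : ℝ) ^ (d₁ : ℕ) ≤ ‖(s₀ : ℂ)‖ * (t : ℝ) :=
          mul_le_mul_of_nonneg_left (htpow d₁) (norm_nonneg _)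
      _ = (‖(s₀ : ℂ)‖ / N) * μ := by change _ * (μ / N) = _; ring
      _ ≤ 1 * μ := by
          apply mul_le_mul_of_nonneg_right _ hμpos.le
          rw [div_le_one hNpos, hN]; linarith
      _ ≤ t₀ := by rw [one_mul]; exact hμ₀
  have hst₁ : ‖((1 : ℂˣ) : ℂ)‖ * (t : ℝ) ^ (d₀ : ℕ) ≤ t₁ := by
    rw [Units.val_one, norm_one, one_mul]
    exact (htpow d₀).trans (htμ.trans hμ₁)
  let B : C π :=
    ⟨⟨π.obj b, AngularRegion.isotropicOfTip t, fun _ => AngularRegion.isIsotropic_isotropicOfTip _⟩,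
      b, Iso.refl _⟩
  let g₀ : B ⟶ Z₀ :=
    { fst :=
        { base := e₀, degFr := d₁, scalar := s₀, scalar_mem := hs₀mem,
          mapsTo := Indissect.smul_disc_pow_subset_pullRegion Z₀.fst hX₀ e₀ t d₁ s₀ hst₀ }
      snd := k₀
      w := by
        change (π.map k₀ ≫ Z₀.iso.inv) ≫ Z₀.iso.hom = 𝟙 _ ≫ π.map k₀
        rw [Category.assoc, Iso.inv_hom_id, Category.comp_id, Category.id_comp] }
  let g₁ : B ⟶ Z₁ :=
    { fst :=
        { base := e₁, degFr := d₀, scalar := 1, scalar_mem := one_mem _,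
          mapsTo := Indissect.smul_disc_pow_subset_pullRegion Z₁.fst hX₁ e₁ t d₀ 1 hst₁ }
      snd := k₁
      w := by
        change (π.map k₁ ≫ Z₁.iso.inv) ≫ Z₁.iso.hom = 𝟙 _ ≫ π.map k₁
        rw [Category.assoc, Iso.inv_hom_id, Category.comp_id, Category.id_comp] }
  have hsnd : (g₀ ≫ f₀).snd = (g₁ ≫ f₁).snd := by
    change k₀ ≫ f₀.snd = k₁ ≫ f₁.snd
    exact hk
  have hdeg : C0.degFr (g₀ ≫ f₀).fst = C0.degFr (g₁ ≫ f₁).fst := by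
    rw [CFP.comp_fst, CFP.comp_fst, C0.degFr_comp', C0.degFr_comp']
    change d₁ * d₀ = d₀ * d₁
    exact mul_comm _ _
  have hσ : C0.scalar (g₀ ≫ f₀).fst ^ 2 = C0.scalar (g₁ ≫ f₁).fst ^ 2 := by
    rw [CFP.comp_fst, CFP.comp_fst, C0.scalar_comp', C0.scalar_comp']
    change (e₀.act (C0.scalar f₀.fst) * s₀ ^ (d₀ : ℕ)) ^ 2 = (e₁.act (C0.scalar f₁.fst) * 1 ^ (d₁ : ℕ)) ^ 2
    rw [one_pow, mul_one, mul_pow, hs₀, ← mul_pow, hw, mul_inv_cancel_left]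
  have hFr : (g₀ ≫ f₀) ≫ PreFrobenioid.frobTrans hF Â.obj (dvd_mul_right c 2) =
      (g₁ ≫ f₁) ≫ PreFrobenioid.frobTrans hF Â.obj (dvd_mul_right c 2) :=
    comp_eq_comp_of_scalar_sq_eq π _ _ _ (degFr_fst_frobTrans_two π hF Â.obj c) hsnd hdeg hσ
  haveI := isIso_frob_one π hF B
  let ι : PreFrobenioid.frobPow hF B 1 ⟶ B := inv (PreFrobenioid.frob hF B 1)
  let Bh : PreFrobenioid.Perfection hF := PreFrobenioid.Perfection.root hF B (Â.idx * c)
  let T₀ : PreFrobenioid.Perfection.Level₃ Bh X₀.obj Â := ⟨1, a₀, c, by rw [mul_one]; exact h₀.symm, h₀⟩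
  let T₁ : PreFrobenioid.Perfection.Level₃ Bh X₁.obj Â := ⟨1, a₁, c, by rw [mul_one]; exact h₁.symm, h₁⟩
  let ρ₀ : PreFrobenioid.Perfection.Rep Bh X₀.obj := ⟨T₀.fst, ι ≫ g₀⟩
  let ρ₁ : PreFrobenioid.Perfection.Rep Bh X₁.obj := ⟨T₁.fst, ι ≫ g₁⟩
  refine ⟨⟨Bh, hPall Bh⟩, P.homMk (PreFrobenioid.Perfection.Hom.mk ρ₀), P.homMk (PreFrobenioid.Perfection.Hom.mk ρ₁),
    isNonemptyObj_root_disc π hF b t ht1 (Â.idx * c) P (hPall Bh), ?_⟩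
  change (PreFrobenioid.Perfection.Hom.mk ρ₀ ≫ PreFrobenioid.Perfection.Hom.mk ⟨T₀.snd, f₀⟩ : Bh ⟶ Â) =
    (PreFrobenioid.Perfection.Hom.mk ρ₁ ≫ PreFrobenioid.Perfection.Hom.mk ⟨T₁.snd, f₁⟩ : Bh ⟶ Â)
  rw [PreFrobenioid.Perfection.mk_comp_mk, PreFrobenioid.Perfection.mk_comp_mk,
    ← PreFrobenioid.Perfection.mk_compAt T₀ ρ₀ ⟨T₀.snd, f₀⟩ (PreFrobenioid.Perfection.Level.le_rfl _)
      (PreFrobenioid.Perfection.Level.le_rfl _),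
    ← PreFrobenioid.Perfection.mk_compAt T₁ ρ₁ ⟨T₁.snd, f₁⟩ (PreFrobenioid.Perfection.Level.le_rfl _)
      (PreFrobenioid.Perfection.Level.le_rfl _)]
  let M : PreFrobenioid.Perfection.Level Bh Â := ⟨2, c * 2, (mul_assoc _ _ _)⟩
  have hle₀ : T₀.out.LE M := ⟨one_dvd _, dvd_mul_right c 2⟩
  have hle₁ : T₁.out.LE M := ⟨one_dvd _, dvd_mul_right c 2⟩
  refine PreFrobenioid.Perfection.Hom.mk_eq_mk.mpr ⟨M, hle₀, hle₁, ?_⟩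
  unfold PreFrobenioid.Perfection.compAt
  rw [PreFrobenioid.Perfection.Level.lift_rfl, PreFrobenioid.Perfection.Level.lift_rfl,
    PreFrobenioid.Perfection.Level.lift_rfl, PreFrobenioid.Perfection.Level.lift_rfl]
  refine PreFrobenioid.Perfection.Level.lift_unique T₁.out M hle₁ ?_
  rw [PreFrobenioid.Perfection.Level.lift_spec T₀.out M hle₀]
  change ((ι ≫ g₀) ≫ f₀) ≫ PreFrobenioid.frobTrans hF Â.obj (dvd_mul_right c 2) =
    ((ι ≫ g₁) ≫ f₁) ≫ PreFrobenioid.frobTrans hF Â.obj (dvd_mul_right c 2)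
  simp only [Category.assoc] at hFr ⊢
  rw [hFr]

/-- **Theorem 3.6 (ix) for `C^ℚ := C^pf`** (slot `Thm36Sub.ix_Q`, PROVED, for every value of the slot's
parameter `hF`): if `D` is of strongly indissectible type, then `(C^pf)^istr` is of strongly indissectible type —
with NO complexifiability assumption on `D` (the printed proviso only concerns `Λ = ℤ`).
[cite: MochizukiFrdII2008, Thm 3.6 (ix) p.38] -/
theorem ix_Q_holds (hF : PreFrobenioid.IsFrobenioid (C.toElem π)) :
    Literature.AlgebraicGeometry.Frobenioids.ArchFrd.Thm36Sub.ix_Q π hF := by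
  intro hD _
  let P := PreFrobenioid.isotropicObjects (pfStr π hF)
  have hPall : ∀ Z, P Z := fun Z => istrAll_Q_holds π hF (by decide) Z
  refine ⟨fun Ah => ?_⟩
  rintro ⟨X, φ, -, hsep⟩
  obtain ⟨r₀, hr₀⟩ := PreFrobenioid.Perfection.Hom.mk_surjective (φ 0).hom
  obtain ⟨r₁, hr₁⟩ := PreFrobenioid.Perfection.Hom.mk_surjective (φ 1).hom
  obtain ⟨p₀, hp₀⟩ := exists_dvd_isIsotropic_frobPow π hF (X 0).obj.obj
  obtain ⟨p₁, hp₁⟩ := exists_dvd_isIsotropic_frobPow π hF (X 1).obj.obj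
  let d : ℕ+ := p₀ * p₁
  let c : ℕ+ := r₀.L.b * r₁.L.b * d
  let a₀ : ℕ+ := r₀.L.a * r₁.L.b * d
  let a₁ : ℕ+ := r₁.L.a * r₀.L.b * d
  have eq₀ : (X 0).obj.idx * a₀ = Ah.obj.idx * c := by
    apply PNat.eq
    have h : ((X 0).obj.idx : ℕ) * r₀.L.a = Ah.obj.idx * r₀.L.b := by exact_mod_cast congrArg PNat.val r₀.L.eq
    simp only [a₀, c, PNat.mul_coe]
    calc ((X 0).obj.idx : ℕ) * (r₀.L.a * r₁.L.b * d) = ((X 0).obj.idx * r₀.L.a) * (r₁.L.b * d) := by ring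
      _ = (Ah.obj.idx * r₀.L.b) * (r₁.L.b * d) := by rw [h]
      _ = Ah.obj.idx * (r₀.L.b * r₁.L.b * d) := by ring
  have eq₁ : (X 1).obj.idx * a₁ = Ah.obj.idx * c := by
    apply PNat.eq
    have h : ((X 1).obj.idx : ℕ) * r₁.L.a = Ah.obj.idx * r₁.L.b := by exact_mod_cast congrArg PNat.val r₁.L.eq
    simp only [a₁, c, PNat.mul_coe]
    calc ((X 1).obj.idx : ℕ) * (r₁.L.a * r₀.L.b * d) = ((X 1).obj.idx * r₁.L.a) * (r₀.L.b * d) := by ring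
      _ = (Ah.obj.idx * r₁.L.b) * (r₀.L.b * d) := by rw [h]
      _ = Ah.obj.idx * (r₀.L.b * r₁.L.b * d) := by ring
  have hle₀ : r₀.L.LE ⟨a₀, c, eq₀⟩ :=
    ⟨(dvd_mul_right r₀.L.a r₁.L.b).mul_right d, (dvd_mul_right r₀.L.b r₁.L.b).mul_right d⟩
  have hle₁ : r₁.L.LE ⟨a₁, c, eq₁⟩ :=
    ⟨(dvd_mul_right r₁.L.a r₀.L.b).mul_right d, (dvd_mul_left r₁.L.b r₀.L.b).mul_right d⟩
  let f₀ : PreFrobenioid.frobPow hF (X 0).obj.obj a₀ ⟶ PreFrobenioid.frobPow hF Ah.obj.obj c :=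
    PreFrobenioid.Perfection.Level.lift r₀.L ⟨a₀, c, eq₀⟩ hle₀ r₀.hom
  let f₁ : PreFrobenioid.frobPow hF (X 1).obj.obj a₁ ⟶ PreFrobenioid.frobPow hF Ah.obj.obj c :=
    PreFrobenioid.Perfection.Level.lift r₁.L ⟨a₁, c, eq₁⟩ hle₁ r₁.hom
  have hφ₀ : (φ 0).hom = PreFrobenioid.Perfection.Hom.mk ⟨⟨a₀, c, eq₀⟩, f₀⟩ := by
    rw [← hr₀]; exact (PreFrobenioid.Perfection.Hom.mk_lift r₀ ⟨a₀, c, eq₀⟩ hle₀).symm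
  have hφ₁ : (φ 1).hom = PreFrobenioid.Perfection.Hom.mk ⟨⟨a₁, c, eq₁⟩, f₁⟩ := by
    rw [← hr₁]; exact (PreFrobenioid.Perfection.Hom.mk_lift r₁ ⟨a₁, c, eq₁⟩ hle₁).symm
  have hX₀ : (PreFrobenioid.frobPow hF (X 0).obj.obj a₀).fst.IsNaivelyIsotropic :=
    isNaivelyIsotropic_fst_of_isIsotropic π _ (hp₀ a₀ ((dvd_mul_right p₀ p₁).mul_left _))
  have hX₁ : (PreFrobenioid.frobPow hF (X 1).obj.obj a₁).fst.IsNaivelyIsotropic :=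
    isNaivelyIsotropic_fst_of_isIsotropic π _ (hp₁ a₁ ((dvd_mul_left p₁ p₀).mul_left _))
  obtain ⟨b, k₀, k₁, hk⟩ := Indissect.exists_square hD
    (fun i => PreFrobenioid.baseObj (C.toElem π) (X i).obj.obj)
    (fun i => PreFrobenioid.Perfection.Hom.baseMap (φ i).hom)
  have hk' : (k₀ ≫ PreFrobenioid.Base (C.toElem π) (PreFrobenioid.frob hF (X 0).obj.obj a₀)) ≫ f₀.snd =
      (k₁ ≫ PreFrobenioid.Base (C.toElem π) (PreFrobenioid.frob hF (X 1).obj.obj a₁)) ≫ f₁.snd := by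
    change k₀ ≫ PreFrobenioid.Perfection.Hom.baseMap (φ 0).hom =
      k₁ ≫ PreFrobenioid.Perfection.Hom.baseMap (φ 1).hom at hk
    rw [hφ₀, hφ₁] at hk
    have hk₂ : (k₀ ≫ PreFrobenioid.Perfection.Hom.baseMap
          (PreFrobenioid.Perfection.Hom.mk ⟨⟨a₀, c, eq₀⟩, f₀⟩)) ≫
        PreFrobenioid.Base (C.toElem π) (PreFrobenioid.frob hF Ah.obj.obj c) =
      (k₁ ≫ PreFrobenioid.Perfection.Hom.baseMap
          (PreFrobenioid.Perfection.Hom.mk ⟨⟨a₁, c, eq₁⟩, f₁⟩)) ≫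
        PreFrobenioid.Base (C.toElem π) (PreFrobenioid.frob hF Ah.obj.obj c) := by rw [hk]
    rw [baseMap_mk_comp_base_frob, baseMap_mk_comp_base_frob] at hk₂
    rw [Category.assoc, Category.assoc]
    exact hk₂
  obtain ⟨Bh, ψ₀, ψ₁, hBh, hcomm⟩ :=
    exists_pf_square π hF P hPall (X₀ := X 0) (X₁ := X 1) eq₀ eq₁ f₀ f₁ hX₀ hX₁ _ _ hk'
  refine hsep (i := 0) (j := 1) (by decide) hBh ψ₀ ψ₁ ?_
  apply ObjectProperty.hom_ext
  rw [ObjectProperty.FullSubcategory.comp_hom, ObjectProperty.FullSubcategory.comp_hom, hφ₀, hφ₁]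
  exact hcomm

/-- The `Λ = ℚ` conjunct of abc-iut-L1-t9's instance statement `Thm36ix_CA π (pfCompletion hF) rlf` — `Thm36ix`
for the structure functor of THE perfection — holds (definitional bridge `thm36ix_instance_Q_iff` of
`Thm36Sub.lean`). [cite: MochizukiFrdII2008, Thm 3.6 (ix) p.38] -/
theorem thm36ix_instance_Q (hF : PreFrobenioid.IsFrobenioid (C.toElem π)) (rlf : LambdaCompletion π) :
    Thm36ix (baseRC π) (archFrobenioid π (pfCompletion π hF) rlf .Q).str .Q :=
  (thm36ix_instance_Q_iff π hF rlf).mpr (ix_Q_holds π hF)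

end Thm36Sub

end ArchFrd

end Literature.AlgebraicGeometry.Frobenioids

end
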